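import Mathlib
import Literature.NumberTheory.LFunctions.Zhang2022.Section4Statements
import HarnessLib

/-!
# Zhang (2022) §4, Lemma 4.4: the manuscript's proof chain, I — the reduction of Lemma 4.4 to
# (4.7)–(4.9) and the `𝓛⁻¹⁸⁰` bound for the `g`-sum, PROVED against the typed statements of
# `Section4Statements`

Topic `Literature/NumberTheory/LFunctions/Zhang2022` (Landau–Siegel adjudication tree;
verdict-neutral). Y. Zhang, *Discrete mean estimates and the Landau–Siegel zero*,
arXiv:2211.02515v1 (2022) [Zhang2022LandauSiegel] — **an unrefereed manuscript under adjudication**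
— §4, Lemma 4.4 and its proof (PDF pp. 19–20, tex L1040–L1125):

> **Lemma 4.4.** Let `Ω₃ = {s : 1/2 − α < σ < 1 + α, |t − 2πt₀| < 𝓛₁ + 3}`. If `s ∈ Ω₃`, then
> `L(s,ψ)L(s,ψχ) = F(s,ψ) + Z̃(s,ψ)F(1−s,ψ̄) + O(𝓛⁻¹⁷⁹)`.
> *Proof.* By the residue theorem, `L(s,ψ)L(s,ψχ) = (2πi)⁻¹(∫_{(1)} − ∫_{(−σ−1/2)}) L(s+w,ψ)L(s+w,ψχ)
> P^{(9/5)w} ω₁(w)dw/w`. By (4.2) and (4.3), [the line `(1)`] `= F(s,ψ) + Σ_{D⁴<n<P²}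
> ν(n)ψ(n)n^{−s}g(P^{9/5}/n) + O(ε)` where `ε = exp{−c𝓛¹⁰}`. By (3.5) and partial summation, the
> second sum […] `≪ 𝓛₁(|X₃(P²,ψ)| + ∫_{D⁴}^{P²}|X₃(x,ψ)|x⁻¹dx) ≪ 𝓛⁻¹⁸⁰`. On the other hand, by the
> functional equation […]. This sum is split into three sums […]. The proof is therefore reduced to
> showing (4.7), (4.8), (4.9). […] By a trivial bound for `ω₁(w)` and (4.5) we see that the left side
> of (4.8) is `≪ P^{1−2σ}∫_{−𝓛²⁰}^{𝓛²⁰}|Σ_{D⁴<n≤P²} ν(n)ψ(n)n^{−(s*+iv)}| dv/(α+iv) + ε` with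
> `s* = 1 + α − s̄`. By partial integration, `Σ_{D⁴<n≤P²} ν(n)ψ(n)n^{−(s*+iv)} = ∫_{D⁴}^{P²}
> x^{s₀−s*−iv}dX₃(x,ψ) ≪ P^{2σ−1}𝓛₁(|X₃(P²,ψ)| + ∫_{D⁴}^{P²}|X₃(x,ψ)|x⁻¹dx)` for `|v| ≤ 𝓛²⁰`.
> From this and (3.5) we obtain (4.8).

The campaign's statements file `Section4Statements.lean` (L1-t3) types every display of this proof
as a named `Prop` over the skeleton (`ResidueSplit`, `LineOneEval`, `GSumBound`, `GSumBound180`,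
`ThreeWaySplit`, `Eq47`, `Eq48`, `Eq49`, `Line48Bound`, `MidSumPI`, …) and the manuscript's
DEDUCTIONS as the claim-implications `Ded44`, `Ded48a`, `Ded48b`. This file PROVES (theorems only;
no definition, no new named fact; DAG node ids of `plan/DAG.tsv` in each docstring):

* `Section4.ded44_holds : Ded44` — **`Z22:Lem4.4.pf`**: the reduction "`ResidueSplit → LineOneEval →
  GSumBound180 → ThreeWaySplit → Eq47 → Eq48 → Eq49 → Skeleton.Lemma44`" is a valid deduction
  (bookkeeping `e^{−c𝓛¹⁰}, P^{−c} ≤ 𝓛⁻¹⁷⁹` eventually, `𝓛⁻¹⁸⁰ ≤ 𝓛⁻¹⁷⁹`);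
* `Section4.gSumBound180_of : GSumBound → GSumBound180` — **`Z22:§4.u028`**, second `≪`: by (3.5)
  for `ψ ∈ Ψ₁` (`Skeleton.Ineq35`), `𝓛₁·𝓛⁻⁵⁸⁵ = 𝓛⁻¹⁸⁰`;
The sibling file `Section4Eq48Deduction.lean` proves `Ded48b` (`Z22:(4.8)` second deduction) and
`MidSumPI` (`Z22:§4.u035`, fully).

What is NOT proved here (they remain CLAIMS of the manuscript, typed in `Section4Statements`): the
residue split, the evaluation of the line `Re w = 1`, the first `≪` of `Z22:§4.u028` (`GSumBound`,
partial summation with the weight `g`), the functional-equation line, the three-way split, the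
contour shifts and contour bounds behind (4.7)/(4.9), and the majorant `Line48Bound`. Hence
`Skeleton.Lemma44` itself is NOT discharged; nothing about Theorems 1–2 of the source or about
Landau–Siegel zeros is stated or implied.

## References

* Y. Zhang, arXiv:2211.02515v1 (2022), §4 Lemma 4.4 (proof), pp. 19–20; (3.5) p. 15; (2.6)–(2.8).
  [cite: Zhang2022LandauSiegel, §4 Lemma 4.4 (proof) pp. 19–20]
* Mathlib, `Mathlib/NumberTheory/AbelSummation.lean`; `Real.arsinh` (`Mathlib/Analysis/SpecialFunctions/Arsinh.lean`).
-/

noncomputable section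

open Complex Real ComplexConjugate MeasureTheory

namespace Literature.NumberTheory.LFunctions.Zhang2022.Section4

open Skeleton


/-! ### Small eventual-size lemmas: `e^{−c𝓛^m} ≤ 𝓛^{−k}`, `P^{−c} ≤ 𝓛^{−k}` -/

/-- For `c > 0`, `m ≥ 2` and any `k`: `exp(−cL^m) ≤ (L^k)⁻¹` as soon as `L ≥ max 1 (k/c)` (the
size comparison behind "`O(ε)`, `O(P^{−c})` are admissible", `ε = e^{−c𝓛¹⁰}`, `P = e^{𝓛⁹}`).
[cite: Zhang2022LandauSiegel, §4 Lemma 4.4 (proof) p. 19] -/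
theorem exp_neg_mul_pow_le_inv_pow {c : ℝ} (hc : 0 < c) {m : ℕ} (hm : 2 ≤ m) (k : ℕ) {L : ℝ}
    (hL1 : 1 ≤ L) (hLk : (k : ℝ) / c ≤ L) : Real.exp (-c * L ^ m) ≤ (L ^ k)⁻¹ := by
  have hL0 : 0 < L := lt_of_lt_of_le zero_lt_one hL1
  have hLk' : (k : ℝ) ≤ c * L := by rwa [div_le_iff₀' hc] at hLk
  -- `k log L ≤ k L ≤ c L² ≤ c L^m`
  have hlog : Real.log L ≤ L := (Real.log_le_sub_one_of_pos hL0).trans (by linarith)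
  have h1 : (k : ℝ) * Real.log L ≤ c * L ^ m := by
    calc (k : ℝ) * Real.log L ≤ k * L := by
          exact mul_le_mul_of_nonneg_left hlog (Nat.cast_nonneg k)
      _ ≤ c * L * L := by exact mul_le_mul_of_nonneg_right hLk' hL0.le
      _ = c * L ^ 2 := by ring
      _ ≤ c * L ^ m := by
          exact mul_le_mul_of_nonneg_left (pow_le_pow_right₀ hL1 hm) hc.le
  have hk : (L ^ k)⁻¹ = Real.exp (-((k : ℝ) * Real.log L)) := by
    rw [Real.exp_neg, ← Real.log_pow, Real.exp_log (pow_pos hL0 k)]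
  rw [hk]
  exact Real.exp_le_exp.mpr (by linarith)

/-- `𝓛 = log D ≥ L₀` once `D ≥ ⌈exp L₀⌉₊` ("`D` sufficiently large", `𝓛 = log D` (2.1)).
[cite: Zhang2022LandauSiegel, §2 (2.1)] -/
theorem le_ell_of_ceil_exp_le {L₀ : ℝ} {D : ℕ} (hD : ⌈Real.exp L₀⌉₊ ≤ D) : L₀ ≤ ell D := by
  have h : Real.exp L₀ ≤ D := le_trans (Nat.le_ceil _) (by exact_mod_cast hD)
  exact (Real.le_log_iff_exp_le (lt_of_lt_of_le (Real.exp_pos _) h)).mpr h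

/-- `P^{−c} = exp(−c𝓛⁹)`. [cite: Zhang2022LandauSiegel, §2 (2.6)] -/
theorem bigP_rpow_neg (D : ℕ) (c : ℝ) : bigP D ^ (-c) = Real.exp (-c * ell D ^ 9) := by
  rw [bigP, ← Real.exp_mul]; ring_nf

/-- `ε = e^{−c𝓛¹⁰} ≤ 𝓛^{−k}` for `𝓛 ≥ max 1 (k/c)`. [cite: Zhang2022LandauSiegel, §4 p. 19] -/
theorem epsW_le_inv_pow {c : ℝ} (hc : 0 < c) (k : ℕ) {D : ℕ} (hL1 : 1 ≤ ell D)
    (hLk : (k : ℝ) / c ≤ ell D) : epsW c D ≤ (ell D ^ k)⁻¹ :=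
  exp_neg_mul_pow_le_inv_pow hc (by norm_num) k hL1 hLk

/-- `P^{−c} ≤ 𝓛^{−k}` for `𝓛 ≥ max 1 (k/c)`. [cite: Zhang2022LandauSiegel, §2 (2.6)] -/
theorem bigP_rpow_neg_le_inv_pow {c : ℝ} (hc : 0 < c) (k : ℕ) {D : ℕ} (hL1 : 1 ≤ ell D)
    (hLk : (k : ℝ) / c ≤ ell D) : bigP D ^ (-c) ≤ (ell D ^ k)⁻¹ := by
  rw [bigP_rpow_neg]
  exact exp_neg_mul_pow_le_inv_pow hc (by norm_num) k hL1 hLk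

/-! ### Z22:Lem4.4.pf — the manuscript's reduction of Lemma 4.4 to (4.7), (4.8), (4.9) -/

/-- **The manuscript's proof of Lemma 4.4 is a valid deduction** (DAG `Z22:Lem4.4.pf`,
[Z22 pp. 19–20, tex L1049–L1082]): the typed node `Section4.Ded44` HOLDS — from the residue split
`L(s,ψ)L(s,ψχ) = I₁ − I₂` (`ResidueSplit`), the evaluation of the line `Re w = 1`
`I₁ = F(s,ψ) + Σ g + O(ε)` (`LineOneEval`), the bound `Σ g ≪ 𝓛⁻¹⁸⁰` for `ψ ∈ Ψ₁` (`GSumBound180`),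
the three-way split of `I₂` (`ThreeWaySplit`) and (4.7), (4.8), (4.9) (`Eq47`, `Eq48`, `Eq49`)
it follows that `L(s,ψ)L(s,ψχ) − F(s,ψ) − Z̃(s,ψ)F(1−s,ψ̄) ≪ 𝓛⁻¹⁷⁹` on `Ω₃` for `ψ ∈ Ψ₁`, i.e.
`Skeleton.Lemma44`. Bookkeeping: `C₁e^{−c𝓛¹⁰} + C₂𝓛⁻¹⁸⁰ + C₃P^{−c′} + C₄𝓛⁻¹⁷⁹ + C₅P^{−c″} ≤ C𝓛⁻¹⁷⁹`
once `𝓛 ≥ max 1 (179/min(c,c′,c″))` (`P = e^{𝓛⁹}`). Kernel-checked; the seven inputs stay CLAIMS.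
[cite: Zhang2022LandauSiegel, §4 Lemma 4.4 (proof) pp. 19–20] -/
theorem ded44_holds : Ded44 := by
  intro hRS hL1 hG hTW h47 h48 h49
  obtain ⟨c₁, hc₁, C₁, hL1⟩ := hL1
  obtain ⟨C₂, hG⟩ := hG
  obtain ⟨c₃, hc₃, C₃, h47⟩ := h47
  obtain ⟨C₄, h48⟩ := h48
  obtain ⟨c₅, hc₅, C₅, h49⟩ := h49
  obtain ⟨D₀, hall⟩ := (((((hRS.and hL1).and hG).and hTW).and h47).and h48).and h49
  -- threshold making every error term `≤ 𝓛⁻¹⁷⁹`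
  set L₀ : ℝ := max 1 (max ((179 : ℕ) / c₁) (max ((179 : ℕ) / c₃) ((179 : ℕ) / c₅))) with hL₀
  refine ⟨max C₁ 0 + max C₂ 0 + max C₃ 0 + max C₄ 0 + max C₅ 0, max D₀ ⌈Real.exp L₀⌉₊,
    fun D _ χ hD hq hp x hx s hs => ?_⟩
  obtain ⟨⟨⟨⟨⟨⟨hRS', hL1'⟩, hG'⟩, hTW'⟩, h47'⟩, h48'⟩, h49'⟩ :=
    hall D χ (le_trans (le_max_left _ _) hD) hq hp
  have hL₀D : L₀ ≤ ell D := le_ell_of_ceil_exp_le (le_trans (le_max_right _ _) hD)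
  have hL1D : 1 ≤ ell D := le_trans (le_max_left _ _) hL₀D
  have hc₁D : ((179 : ℕ) : ℝ) / c₁ ≤ ell D :=
    le_trans (le_trans (le_max_left _ _) (le_max_right _ _)) hL₀D
  have hc₃D : ((179 : ℕ) : ℝ) / c₃ ≤ ell D :=
    le_trans (le_trans (le_trans (le_max_left _ _) (le_max_right _ _)) (le_max_right _ _)) hL₀D
  have hc₅D : ((179 : ℕ) : ℝ) / c₅ ≤ ell D :=
    le_trans (le_trans (le_trans (le_max_right _ _) (le_max_right _ _)) (le_max_right _ _)) hL₀D
  have hℓ : 0 < ell D := lt_of_lt_of_le zero_lt_one hL1D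
  set T : ℝ := (ell D ^ 179)⁻¹ with hT
  have hT0 : 0 ≤ T := by positivity
  -- the five error terms
  have e1 : ‖perronLine D (fun w => LL χ x (s + w)) 1 - (Fpoly χ x s + gSum χ x s)‖ ≤ max C₁ 0 * T :=
    calc _ ≤ C₁ * epsW c₁ D := hL1' x s hs
      _ ≤ max C₁ 0 * epsW c₁ D :=
          mul_le_mul_of_nonneg_right (le_max_left _ _) (Real.exp_pos _).le
      _ ≤ max C₁ 0 * T :=
          mul_le_mul_of_nonneg_left (epsW_le_inv_pow hc₁ 179 hL1D hc₁D) (le_max_right _ _)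
  have e2 : ‖gSum χ x s‖ ≤ max C₂ 0 * T :=
    calc _ ≤ C₂ * (ell D ^ 180)⁻¹ := hG' x hx s hs
      _ ≤ max C₂ 0 * (ell D ^ 180)⁻¹ :=
          mul_le_mul_of_nonneg_right (le_max_left _ _) (by positivity)
      _ ≤ max C₂ 0 * T := by
          refine mul_le_mul_of_nonneg_left ?_ (le_max_right _ _)
          exact inv_anti₀ (by positivity) (pow_le_pow_right₀ hL1D (by norm_num))
  have e3 : ‖perronLine D (f47 χ x s) (-s.re - 1 / 2) + tildeZW χ x s * FpolyBar χ x (1 - s)‖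
      ≤ max C₃ 0 * T :=
    calc _ ≤ C₃ * bigP D ^ (-c₃) := h47' x s hs
      _ ≤ max C₃ 0 * bigP D ^ (-c₃) :=
          mul_le_mul_of_nonneg_right (le_max_left _ _) (Real.rpow_nonneg (Real.exp_pos _).le _)
      _ ≤ max C₃ 0 * T :=
          mul_le_mul_of_nonneg_left (bigP_rpow_neg_le_inv_pow hc₃ 179 hL1D hc₃D) (le_max_right _ _)
  have e4 : ‖perronLine D (f48 χ x s) (-s.re - 1 / 2)‖ ≤ max C₄ 0 * T :=
    calc _ ≤ C₄ * (ell D ^ 179)⁻¹ := h48' x hx s hs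
      _ ≤ max C₄ 0 * T := mul_le_mul_of_nonneg_right (le_max_left _ _) hT0
  have e5 : ‖perronLine D (f49 χ x s) (-s.re - 1 / 2)‖ ≤ max C₅ 0 * T :=
    calc _ ≤ C₅ * bigP D ^ (-c₅) := h49' x s hs
      _ ≤ max C₅ 0 * bigP D ^ (-c₅) :=
          mul_le_mul_of_nonneg_right (le_max_left _ _) (Real.rpow_nonneg (Real.exp_pos _).le _)
      _ ≤ max C₅ 0 * T :=
          mul_le_mul_of_nonneg_left (bigP_rpow_neg_le_inv_pow hc₅ 179 hL1D hc₅D) (le_max_right _ _)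
  -- the algebra: `LL − F − Z̃F̄(1−s) = (I₁ − F − Σg) + Σg − (I47 + Z̃F̄(1−s)) − I48 − I49`
  have hid : LL χ x s - Fpoly χ x s - tildeZW χ x s * FpolyBar χ x (1 - s)
      = (perronLine D (fun w => LL χ x (s + w)) 1 - (Fpoly χ x s + gSum χ x s))
        + gSum χ x s
        - (perronLine D (f47 χ x s) (-s.re - 1 / 2) + tildeZW χ x s * FpolyBar χ x (1 - s))
        - perronLine D (f48 χ x s) (-s.re - 1 / 2)
        - perronLine D (f49 χ x s) (-s.re - 1 / 2) := by
    rw [hRS' x s hs, hTW' x s hs]; ring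
  rw [hid]
  calc _ ≤ ‖perronLine D (fun w => LL χ x (s + w)) 1 - (Fpoly χ x s + gSum χ x s)‖
        + ‖gSum χ x s‖
        + ‖perronLine D (f47 χ x s) (-s.re - 1 / 2) + tildeZW χ x s * FpolyBar χ x (1 - s)‖
        + ‖perronLine D (f48 χ x s) (-s.re - 1 / 2)‖
        + ‖perronLine D (f49 χ x s) (-s.re - 1 / 2)‖ := by
          refine le_trans (norm_sub_le _ _) ?_
          gcongr
          refine le_trans (norm_sub_le _ _) ?_
          gcongr
          refine le_trans (norm_sub_le _ _) ?_
          gcongr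
          exact norm_add_le _ _
    _ ≤ max C₁ 0 * T + max C₂ 0 * T + max C₃ 0 * T + max C₄ 0 * T + max C₅ 0 * T := by
          linarith [e1, e2, e3, e4, e5]
    _ = (max C₁ 0 + max C₂ 0 + max C₃ 0 + max C₄ 0 + max C₅ 0) * (ell D ^ 179)⁻¹ := by
          rw [hT]; ring

/-! ### Z22:§4.u028, second `≪`: `Σ g ≪ 𝓛⁻¹⁸⁰` from the partial-summation bound and (3.5) -/

/-- **"`… ≪ 𝓛⁻¹⁸⁰`" follows from "`≪ 𝓛₁(|X₃(P²,ψ)| + ∫_{D⁴}^{P²}|X₃(x,ψ)|x⁻¹dx)`" and (3.5)**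
(DAG `Z22:§4.u028`, [Z22 p. 19, tex L1062–L1066]): the typed node `GSumBound` implies the typed node
`GSumBound180`, because `ψ ∈ Ψ₁` satisfies (3.5) (`Skeleton.Ineq35`: the bracket is `< 𝓛⁻⁵⁸⁵`) and
`𝓛₁𝓛⁻⁵⁸⁵ = 𝓛⁴⁰⁵⁻⁵⁸⁵ = 𝓛⁻¹⁸⁰`. Kernel-checked. [cite: Zhang2022LandauSiegel, §4 Lemma 4.4 (proof) p. 19] -/
theorem gSumBound180_of (h : GSumBound) : GSumBound180 := by
  obtain ⟨C, h⟩ := h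
  obtain ⟨D₀, h⟩ := h
  refine ⟨max C 0, max D₀ ⌈Real.exp 2⌉₊, fun D _ χ hD hq hp x hx s hs => ?_⟩
  have h' := h D χ (le_trans (le_max_left _ _) hD) hq hp x s hs
  have hℓ2 : 2 ≤ ell D := le_ell_of_ceil_exp_le (le_trans (le_max_right _ _) hD)
  have hℓ1 : 1 ≤ ell D := le_trans one_le_two hℓ2
  have hℓ : 0 < ell D := lt_of_lt_of_le zero_lt_one hℓ1
  have hD0 : (0 : ℝ) < D := by
    have h8 : (1 : ℕ) ≤ ⌈Real.exp 2⌉₊ := Nat.one_le_iff_ne_zero.mpr (by positivity)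
    exact_mod_cast lt_of_lt_of_le Nat.one_pos (le_trans h8 (le_trans (le_max_right _ _) hD))
  have h35 : ‖X3 χ x (bigP D ^ 2)‖ + ∫ y in (D : ℝ) ^ 4..bigP D ^ 2, ‖X3 χ x y‖ / y
      < (ell D ^ 585)⁻¹ := hx.2.1
  set B : ℝ := ‖X3 χ x (bigP D ^ 2)‖ + ∫ y in (D : ℝ) ^ 4..bigP D ^ 2, ‖X3 χ x y‖ / y with hB
  -- `D⁴ ≤ P²` (so the integral of the nonnegative integrand is nonnegative)
  have hD4P2 : (D : ℝ) ^ 4 ≤ bigP D ^ 2 := by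
    have hD' : (D : ℝ) = Real.exp (ell D) := by rw [ell, Real.exp_log hD0]
    have h8 : (2 : ℝ) ^ 8 ≤ ell D ^ 8 := pow_le_pow_left₀ (by norm_num) hℓ2 8
    have hexp : (4 : ℕ) * ell D ≤ (2 : ℕ) * ell D ^ 9 := by
      push_cast
      calc 4 * ell D ≤ 2 * (ell D * ell D ^ 8) := by nlinarith [h8, hℓ.le]
        _ = 2 * ell D ^ 9 := by ring
    rw [hD', bigP, ← Real.exp_nat_mul, ← Real.exp_nat_mul]
    exact Real.exp_le_exp.mpr hexp
  have hint : 0 ≤ ∫ y in (D : ℝ) ^ 4..bigP D ^ 2, ‖X3 χ x y‖ / y := by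
    refine intervalIntegral.integral_nonneg hD4P2 fun y hy => ?_
    exact div_nonneg (norm_nonneg _) (le_trans (by positivity) hy.1)
  have hB0 : 0 ≤ B := add_nonneg (norm_nonneg _) hint
  have hℓ1' : 0 ≤ ell1 D := by rw [ell1]; positivity
  have h2 : ell1 D * (ell D ^ 585)⁻¹ = (ell D ^ 180)⁻¹ := by
    rw [ell1]; field_simp
  calc ‖gSum χ x s‖ ≤ C * ell1 D * B := h'
    _ ≤ max C 0 * ell1 D * B :=
        mul_le_mul_of_nonneg_right (mul_le_mul_of_nonneg_right (le_max_left _ _) hℓ1') hB0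
    _ = max C 0 * (ell1 D * B) := by ring
    _ ≤ max C 0 * (ell1 D * (ell D ^ 585)⁻¹) :=
        mul_le_mul_of_nonneg_left (mul_le_mul_of_nonneg_left h35.le hℓ1') (le_max_right _ _)
    _ = max C 0 * (ell D ^ 180)⁻¹ := by rw [h2]

end Literature.NumberTheory.LFunctions.Zhang2022.Section4

end
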